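import Summits.BirchSwinnertonDyer.BirchSwinnertonDyer.Theorems.ThetaPartnerAtTwoMazurTateCongruenceAtTwoTopOfPublishedInputs
import HarnessLib

/-!
# Line `symbol` v8 (lead seat `bsd-wall-tp2-p1`, g11) — crux `MazurTateCongruenceAtTwoTop` (stmt-BirchSwinnertonDyer-25797,
# `:= MazurTateCongruenceAtTwoR` = stmt-21416 BY NAME) of route `route-BirchSwinnertonDyer-ThetaPartnerAtTwo` (cell bsd-wall, K1 row)

v7 → v8 (same gen; FINAL shape). The cell converged on the lead's μ-FREE IHARA ROAD (memo `K1ROW-LEAD-g11.md`): the assembly's symbol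
statement needs a `2`-adic unit value of the Néron-normalised depleted plus symbol ANYWHERE on `ℚ`; undepleted this always holds
(Manin cusp + period fact); depletion preserving it is Ihara's lemma mod `2` in symbol form (IH₂⁻), for which the lead landed the
plumbing `stub_depletionPrimitiveNegDisc_of_ihara` (p630314) and the crux theorems `…_of_fourFacts_depletionPrimitiveNegDisc` (p629892) /
`…_of_fourFacts_ihara` (p631190); width seat tp2-p1-w3 g0 then PROVED (IH₂⁻) in the tree — `MazurTateCongruenceAtTwoR.stub_iharaSymbolModTwoNegDisc`
(p631156: `eq_zero_of_dilationInvariant` over cell bsd-f2-manin's relative Ihara `ManinLocalTwoThree.relativeIharaShiftVanishingBar_holds`,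
+ tp2-p1-w2 g3's `not_isEisensteinEigensystem_two_of_Δ_neg` p630663) — and composed `mazurTateCongruenceAtTwoTop_of_publishedInputsHeckeAtTwo`
(p631563, `…TopOfPublishedInputs`): **the crux BY NAME from the route's own PUB⁵ support item `PublishedInputsHeckeAtTwo`
(stmt-BirchSwinnertonDyer-27435: Eichler–Shimura for the depleted optimal quotient ∧ Hecke self-duality ∧ Buzzard's mod-`2` multiplicity one ∧
Serre 1972 Prop. 12 ∧ Abbes–Ullmo Thm. A) ALONE** — no `μ`-statement, no (G′)_N node (the split's node child 27436 is not needed for K1),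
no research input. (The lead's cite-only Literature reading `ribet1984_ihara_modTwo_symbolForm`, p632620, is thereby a THEOREM of the tree:
`…TopIharaFactHolds`.)

So v8 registers ONE stub, the route's PUB⁵ item itself:
* `stub_pubPublishedInputsHeckeAtTwo : Theses.ThetaPartnerAtTwo.PublishedInputsHeckeAtTwo` (item 27435, HOLD, cite-level bundle; never a
  prover target).
COMPOSITION (LANDED, 0 sorry): `MazurTateCongruenceAtTwoR.mazurTateCongruenceAtTwoTop_of_publishedInputsHeckeAtTwo` (p631563).
HONEST FRAMING: nothing here proves BSD; the crux is closed ONLY MODULO the five named print facts of item 27435; the stub below is `sorry`.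
-/

set_option linter.dupNamespace false
set_option autoImplicit false

noncomputable section

namespace Summit.BirchSwinnertonDyer.BirchSwinnertonDyer.Cruxes.MazurTateCongruenceAtTwoTop.Symbol

/-- PUB stub (cite_only bundle = route item stmt-BirchSwinnertonDyer-27435 `PublishedInputsHeckeAtTwo`): Eichler–Shimura period lattice of
the depleted optimal quotient ∧ Hecke self-duality of `J₀(N)[ℓ]` ∧ Buzzard's mod-`2` multiplicity one on `Γ₀` ∧ Serre 1972 Prop. 12 ∧
Abbes–Ullmo Thm. A. [cite: Buzzard2000LevelLoweringModTwo, Prop. 2.4] [cite: Serre1972, Prop. 12] [cite: AbbesUllmo1996, Thm. A] -/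
theorem stub_pubPublishedInputsHeckeAtTwo :
    Summit.BirchSwinnertonDyer.BirchSwinnertonDyer.Theses.ThetaPartnerAtTwo.PublishedInputsHeckeAtTwo := by
  sorry

/-- **Composition**: the crux `MazurTateCongruenceAtTwoTop` BY NAME from the single registered stub (the route's PUB⁵ item), through
tp2-p1-w3 g0's landed `mazurTateCongruenceAtTwoTop_of_publishedInputsHeckeAtTwo` (p631563) = the lead's `…_of_fourFacts_depletionPrimitiveNegDisc`
∘ `stub_depletionPrimitiveNegDisc_of_ihara` ∘ w3's `stub_iharaSymbolModTwoNegDisc`. [cite: GreenbergVatsal2000, Thm. (1.4) and §3 (13)]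
[cite: Ribet1984ICM, Thm. 4.3] -/
theorem MazurTateCongruenceAtTwoTop_of :
    Summit.BirchSwinnertonDyer.BirchSwinnertonDyer.Theses.ThetaPartnerAtTwo.MazurTateCongruenceAtTwoTop :=
  Summit.BirchSwinnertonDyer.BirchSwinnertonDyer.Theorems.MazurTateCongruenceAtTwoR.mazurTateCongruenceAtTwoTop_of_publishedInputsHeckeAtTwo
    stub_pubPublishedInputsHeckeAtTwo

end Summit.BirchSwinnertonDyer.BirchSwinnertonDyer.Cruxes.MazurTateCongruenceAtTwoTop.Symbol

end
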